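import Mathlib
import Summits.Ventures.DiscreteObjects.Mahler.NonreciprocalMeasureBound
import Summits.Ventures.DiscreteObjects.Mahler.HeightCells

/-!
# The sub-Lehmer census kernel without Smyth's theorem (venture `DiscreteObjects`, target L)

Cell `pub-namedobj`, seat `pub-namedobj-mahler` (gen 7). Framing: lottery ticket; floor = certified
bounds/negative ranges.

The kernel assemblies of the height-bounded sub-Lehmer census (`SubLehmerStructure`,
`Height1CensusCells`, `Height1CensusCellList`, `Height1Ladder`, `HeightCells`) were stated conditional on
TWO named facts: `SubLehmerDegreeBound` ([MRW08, Thm 1.1], a published computation) and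
`NonreciprocalMahlerBound` (Smyth 1971, `M ≥ θ₀` for nonreciprocal `P`).  The second is only used through
"a nonreciprocal polynomial is not sub-Lehmer", which follows from the PROVED bound
`M(P) ≥ (1+√17)/4 > 1.28` of `NonreciprocalMeasureBound` and the kernel enclosure `M(L) < 1.17629`.
This file re-derives every such assembly with the Smyth hypothesis REMOVED (namespace `SmythFree`,
same names and statements otherwise); the census kernel is now conditional on [MRW08, Thm 1.1] alone.
-/

namespace Summit.Ventures.DiscreteObjects.Mahler

open Polynomial Literature.NumberTheory.MahlerMeasure

/-- **No nonreciprocal integer polynomial is sub-Lehmer** (unconditional): if `P(0) ≠ 0` and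
`P.reverse ≠ ± P` then `M(P) > 1.28 > 1.17629 > M(L)`. -/
theorem not_subLehmer_of_nonreciprocal {P : ℤ[X]} (h0 : P.coeff 0 ≠ 0) (h1 : P.reverse ≠ P)
    (h2 : P.reverse ≠ -P) : ¬ SubLehmer P := by
  intro hP
  have hM := intMahlerMeasure_gt_of_nonreciprocal h0 h1 h2
  have hL : intMahlerMeasure lehmerPoly < 117629 / 100000 := lehmer_measure_upper_bound
  linarith [hP.2]

/-- A sub-Lehmer integer polynomial with nonzero constant term is reciprocal or antireciprocal
(unconditional). -/
theorem reverse_eq_or_of_subLehmer {P : ℤ[X]} (hP : SubLehmer P) (h0 : P.coeff 0 ≠ 0) :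
    P.reverse = P ∨ P.reverse = -P := by
  by_contra hnot
  push Not at hnot
  exact not_subLehmer_of_nonreciprocal h0 hnot.1 hnot.2 hP

namespace SmythFree

/-- An irreducible sub-Lehmer polynomial is reciprocal (`Q.reverse = Q`) — unconditional version of
`core_reverse_eq`: nonreciprocal is excluded by `M ≥ (1+√17)/4`, antireciprocal by `Φ₁ ∣ Q`. -/
theorem core_reverse_eq {Q : ℤ[X]} (hirr : Irreducible Q) (hQ : SubLehmer Q) : Q.reverse = Q := by
  have hc0 := core_coeff_zero_ne_zero hirr hQ
  rcases reverse_eq_or_of_subLehmer hQ hc0 with h | hanti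
  · exact h
  · exfalso
    have h1 : Q.eval 1 = 0 := eval_one_eq_zero_of_reverse_eq_neg hanti
    have hdvd : cyclotomic 1 ℤ ∣ Q := by
      rw [cyclotomic_one]; exact dvd_iff_isRoot.mpr h1
    exact core_not_cyclotomic_dvd hirr hQ one_pos hdvd

/-- An irreducible sub-Lehmer polynomial has even degree (unconditional version of
`core_even_natDegree`). -/
theorem core_even_natDegree {Q : ℤ[X]} (hirr : Irreducible Q) (hQ : SubLehmer Q) : Even Q.natDegree := by
  by_contra hodd
  rw [Nat.not_even_iff_odd] at hodd
  have hrev := core_reverse_eq hirr hQ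
  have h1 : Q.eval (-1) = 0 := eval_neg_one_eq_zero_of_reverse_eq hrev hodd
  have hdvd : cyclotomic 2 ℤ ∣ Q := by
    rw [cyclotomic_two]
    have : (X + 1 : ℤ[X]) = X - C (-1) := by simp
    rw [this]; exact dvd_iff_isRoot.mpr h1
  exact core_not_cyclotomic_dvd hirr hQ two_pos hdvd

/-- **Structure theorem**, conditional on [MRW08, Thm 1.1] ONLY (Smyth's hypothesis of
`Mahler.subLehmer_structure` removed): a sub-Lehmer integer polynomial of degree `< 112` is
`± x^a · Φ_{m₁} ⋯ Φ_{m_r} · Q` with `Q` irreducible, sub-Lehmer, `M(Q) = M(P)`, reciprocal, of even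
degree `≥ 56`, with nonzero constant term and no cyclotomic factor, `a + Σ φ(m_i) + deg Q = deg P`. -/
theorem subLehmer_structure (h : SubLehmerDegreeBound) {P : ℤ[X]} (hP : SubLehmer P)
    (hdeg : P.natDegree < 112) :
    ∃ (u : ℤ) (a : ℕ) (s : Multiset ℕ) (Q : ℤ[X]), (u = 1 ∨ u = -1) ∧ (∀ m ∈ s, 0 < m) ∧
      P = C u * X ^ a * (s.map fun m => cyclotomic m ℤ).prod * Q ∧ Irreducible Q ∧ SubLehmer Q ∧
      intMahlerMeasure Q = intMahlerMeasure P ∧ Q.reverse = Q ∧ Even Q.natDegree ∧ 56 ≤ Q.natDegree ∧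
      Q.coeff 0 ≠ 0 ∧ (∀ n : ℕ, 0 < n → ¬ cyclotomic n ℤ ∣ Q) ∧
      a + (s.map Nat.totient).sum + Q.natDegree = P.natDegree := by
  obtain ⟨C, Q, hPCQ, hMC, hQirr, hQ, hMQ, hQ56, hdegs⟩ := subLehmer_core h hP hdeg
  obtain ⟨u, a, s, hu, hs, hCf⟩ := kronecker_form hMC
  refine ⟨u, a, s, Q, hu, hs, by rw [hPCQ, hCf], hQirr, hQ, hMQ, core_reverse_eq hQirr hQ,
    core_even_natDegree hQirr hQ, hQ56, core_coeff_zero_ne_zero hQirr hQ,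
    fun n hn => core_not_cyclotomic_dvd hQirr hQ hn, ?_⟩
  rw [← hdegs, hCf, natDegree_signed_cyclotomic_prod hu]

/-- **Census scope up to degree 60**, conditional on [MRW08, Thm 1.1] ONLY (Smyth's hypothesis of
`Mahler.subLehmer_degree_le_60_structure` removed). -/
theorem subLehmer_degree_le_60_structure (h : SubLehmerDegreeBound) {P : ℤ[X]} (hP : SubLehmer P)
    (hdeg : P.natDegree ≤ 60) :
    ∃ (u : ℤ) (a : ℕ) (s : Multiset ℕ) (Q : ℤ[X]), (u = 1 ∨ u = -1) ∧
      (∀ m ∈ s, m ∈ ({1, 2, 3, 4, 5, 6, 8, 10, 12} : Finset ℕ)) ∧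
      P = C u * X ^ a * (s.map fun m => cyclotomic m ℤ).prod * Q ∧ Irreducible Q ∧ SubLehmer Q ∧
      intMahlerMeasure Q = intMahlerMeasure P ∧ Q.reverse = Q ∧
      (Q.natDegree = 56 ∨ Q.natDegree = 58 ∨ Q.natDegree = 60) ∧
      Q.coeff 0 ≠ 0 ∧ (∀ n : ℕ, 0 < n → ¬ cyclotomic n ℤ ∣ Q) ∧
      a + (s.map Nat.totient).sum + Q.natDegree = P.natDegree ∧ a + (s.map Nat.totient).sum ≤ 4 := by
  obtain ⟨u, a, s, Q, hu, hs, hPf, hQirr, hQ, hMQ, hrev, heven, hQ56, hc0, hncyc, hdegs⟩ :=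
    subLehmer_structure h hP (by omega)
  have hcof : a + (s.map Nat.totient).sum ≤ 4 := by omega
  refine ⟨u, a, s, Q, hu, fun m hm => ?_, hPf, hQirr, hQ, hMQ, hrev, ?_, hc0, hncyc, hdegs, hcof⟩
  · have hle : Nat.totient m ≤ (s.map Nat.totient).sum :=
      Multiset.le_sum_of_mem (Multiset.mem_map_of_mem Nat.totient hm)
    exact Summit.KontsevichZagierPeriods.KzOnePeriods.LemmaN.totient_le_four (hs m hm) (by omega)
  · have hQ60 : Q.natDegree ≤ 60 := by omega
    obtain ⟨k, hk⟩ := heven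
    omega

/-- A sub-Lehmer integer polynomial of degree `56` is reciprocal or antireciprocal, conditional on
[MRW08, Thm 1.1] ONLY (Smyth's hypothesis of `Mahler.reciprocal_of_subLehmer` removed). -/
theorem reciprocal_of_subLehmer (h : SubLehmerDegreeBound) {P : ℤ[X]} (hdeg : P.natDegree = 56)
    (hP : SubLehmer P) : P.reverse = P ∨ P.reverse = -P :=
  reverse_eq_or_of_subLehmer hP (coeff_zero_ne_zero h hdeg hP)

/-- **Assembly (kernel)**, conditional on [MRW08, Thm 1.1] ONLY: if every admissible cell `(s, d)` is
empty then no integer polynomial of degree `≤ 60` and height `≤ 1` is sub-Lehmer. -/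
theorem height1_subLehmer_empty_le_60_of_cells (h : SubLehmerDegreeBound)
    (hcells : ∀ (s : Multiset ℕ) (d : ℕ), AdmissibleCell s d → Height1Cell s d) :
    ∀ P : ℤ[X], P.natDegree ≤ 60 → height P ≤ 1 → ¬ SubLehmer P := by
  intro P hdeg hh hP
  obtain ⟨u, a, s, Q, hu, hs, hPf, hQirr, hQ, _, hrev, hQd, hc0, hncyc, hdegs, _⟩ :=
    subLehmer_degree_le_60_structure h hP hdeg
  have hadm : AdmissibleCell s Q.natDegree := ⟨hs, hQd, by omega⟩
  have hhR : height ((s.map fun m => cyclotomic m ℤ).prod * Q) ≤ 1 := by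
    rw [← height_signed_shift hu a, ← mul_assoc, ← hPf]; exact hh
  exact hcells s Q.natDegree hadm Q rfl hQirr hrev hc0 hncyc hhR hQ

/-- Census-row vocabulary: every height-1 row `(n, 1, M(L))`, `n ≤ 60`, has the EMPTY witness list
(conditional on [MRW08, Thm 1.1] only). -/
theorem heightBoundedCensus_le_60_of_cells (h : SubLehmerDegreeBound)
    (hcells : ∀ (s : Multiset ℕ) (d : ℕ), AdmissibleCell s d → Height1Cell s d) {n : ℕ} (hn : n ≤ 60) :
    HeightBoundedCensus n 1 (intMahlerMeasure lehmerPoly) [] := by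
  rw [heightBoundedCensus_nil_iff]
  intro p hdeg hh h1 hlt
  exact height1_subLehmer_empty_le_60_of_cells h hcells p (by omega) hh ⟨h1, hlt⟩

/-- At degree `56`, `Height1Cell 0 56` gives the headline L6 statement `Height1Degree56SubLehmerEmpty`
(conditional on [MRW08, Thm 1.1] only). -/
theorem height1Degree56SubLehmerEmpty_of_cell (h : SubLehmerDegreeBound) (hcell : Height1Cell 0 56) :
    Height1Degree56SubLehmerEmpty := by
  rw [height1Degree56SubLehmerEmpty_iff]
  intro P hdeg hh hP
  obtain ⟨u, a, s, Q, hu, hs, hPf, hQirr, hQ, _, hrev, hQd, hc0, hncyc, hdegs, _⟩ :=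
    subLehmer_degree_le_60_structure h hP (by omega)
  have hsum0 : (s.map Nat.totient).sum = 0 := by omega
  have hs0 : s = 0 := by
    rcases Multiset.empty_or_exists_mem s with h0 | ⟨m, hm⟩
    · exact h0
    · exfalso
      have hmpos : 0 < m := by
        have := hs m hm
        simp only [Finset.mem_insert, Finset.mem_singleton] at this
        omega
      have hle : Nat.totient m ≤ (s.map Nat.totient).sum :=
        Multiset.le_sum_of_mem (Multiset.mem_map_of_mem Nat.totient hm)
      have := Nat.totient_pos.mpr hmpos
      omega
  subst hs0
  have hQ56 : Q.natDegree = 56 := by omega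
  have hhR : height ((Multiset.map (fun m => cyclotomic m ℤ) 0).prod * Q) ≤ 1 := by
    rw [← height_signed_shift hu a, ← mul_assoc, ← hPf]; exact hh
  exact hcell Q hQ56 hQirr hrev hc0 hncyc hhR hQ

/-- Assembly over the explicit list of `53` admissible cells (conditional on [MRW08, Thm 1.1] only). -/
theorem height1_subLehmer_empty_le_60_of_cellList (h : SubLehmerDegreeBound)
    (hcells : ∀ p ∈ admissibleCellList, Height1Cell p.1 p.2) :
    ∀ P : ℤ[X], P.natDegree ≤ 60 → height P ≤ 1 → ¬ SubLehmer P :=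
  height1_subLehmer_empty_le_60_of_cells h fun s d hsd =>
    hcells (s, d) ((admissibleCell_iff_mem s d).mp hsd)

/-- **Rung `N ≤ 60` of the height-1 ladder from its own cells** (conditional on [MRW08, Thm 1.1]
only). -/
theorem height1SubLehmerEmptyUpTo_of_cells (h : SubLehmerDegreeBound) {N : ℕ} (hN : N ≤ 60)
    (hcells : ∀ (s : Multiset ℕ) (d : ℕ), AdmissibleCell s d → (s.map Nat.totient).sum + d ≤ N →
      Height1Cell s d) :
    Height1SubLehmerEmptyUpTo N := by
  intro P hdeg hh hP
  obtain ⟨u, a, s, Q, hu, hs, hPf, hQirr, hQ, _, hrev, hQd, hc0, hncyc, hdegs, _⟩ :=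
    subLehmer_degree_le_60_structure h hP (le_trans hdeg hN)
  have hadm : AdmissibleCell s Q.natDegree := ⟨hs, hQd, by omega⟩
  have hhR : height ((s.map fun m => cyclotomic m ℤ).prod * Q) ≤ 1 := by
    rw [← height_signed_shift hu a, ← mul_assoc, ← hPf]; exact hh
  exact hcells s Q.natDegree hadm (by omega) Q rfl hQirr hrev hc0 hncyc hhR hQ

/-- Rung `60` from all admissible cells (conditional on [MRW08, Thm 1.1] only). -/
theorem height1SubLehmerEmptyUpTo_60_of_cells (h : SubLehmerDegreeBound)
    (hcells : ∀ (s : Multiset ℕ) (d : ℕ), AdmissibleCell s d → Height1Cell s d) :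
    Height1SubLehmerEmptyUpTo 60 :=
  height1_subLehmer_empty_le_60_of_cells h hcells

/-- **Rung `N ≤ 60` at height `h` from its own cells** (conditional on [MRW08, Thm 1.1] only). -/
theorem heightSubLehmerEmptyUpTo_of_cells (hB : SubLehmerDegreeBound) {h N : ℕ} (hN : N ≤ 60)
    (hcells : ∀ (s : Multiset ℕ) (d : ℕ), AdmissibleCell s d → (s.map Nat.totient).sum + d ≤ N →
      HeightCell h s d) :
    HeightSubLehmerEmptyUpTo h N := by
  intro P hdeg hh hP
  obtain ⟨u, a, s, Q, hu, hs, hPf, hQirr, hQ, _, hrev, hQd, hc0, hncyc, hdegs, _⟩ :=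
    subLehmer_degree_le_60_structure hB hP (le_trans hdeg hN)
  have hadm : AdmissibleCell s Q.natDegree := ⟨hs, hQd, by omega⟩
  have hhR : height ((s.map fun m => cyclotomic m ℤ).prod * Q) ≤ h := by
    rw [← height_signed_shift hu a, ← mul_assoc, ← hPf]; exact hh
  exact hcells s Q.natDegree hadm (by omega) Q rfl hQirr hrev hc0 hncyc hhR hQ

/-- The same over the explicit list of admissible cells (conditional on [MRW08, Thm 1.1] only). -/
theorem heightSubLehmerEmptyUpTo_of_cellList (hB : SubLehmerDegreeBound) {h N : ℕ} (hN : N ≤ 60)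
    (hcells : ∀ p ∈ admissibleCellList, (p.1.map Nat.totient).sum + p.2 ≤ N → HeightCell h p.1 p.2) :
    HeightSubLehmerEmptyUpTo h N :=
  heightSubLehmerEmptyUpTo_of_cells hB hN fun s d hsd hle =>
    hcells (s, d) ((admissibleCell_iff_mem s d).mp hsd) hle

/-- **Degree 56 at any height is ONE cell** (conditional on [MRW08, Thm 1.1] only): `HeightCell h ∅ 56`
gives `HeightSubLehmerEmptyUpTo h 56`. -/
theorem heightSubLehmerEmptyUpTo_56_of_cell (hB : SubLehmerDegreeBound) {h : ℕ}
    (hcell : HeightCell h 0 56) : HeightSubLehmerEmptyUpTo h 56 := by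
  refine heightSubLehmerEmptyUpTo_of_cells hB (by norm_num) fun s d hadm hle => ?_
  obtain ⟨hs, hd, _⟩ := hadm
  have hd56 : d = 56 := by omega
  have hsum0 : (s.map Nat.totient).sum = 0 := by omega
  have hs0 : s = 0 := by
    rcases Multiset.empty_or_exists_mem s with h0 | ⟨m, hm⟩
    · exact h0
    · exfalso
      have hmpos : 0 < m := by
        have := hs m hm
        simp only [Finset.mem_insert, Finset.mem_singleton] at this
        omega
      have hle' : Nat.totient m ≤ (s.map Nat.totient).sum :=
        Multiset.le_sum_of_mem (Multiset.mem_map_of_mem Nat.totient hm)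
      have := Nat.totient_pos.mpr hmpos
      omega
  subst hs0; subst hd56
  exact hcell

/-- In a multiset of positive naturals, `Σ φ = 0` forces the multiset to be empty. -/
theorem eq_zero_of_totient_sum_eq_zero {s : Multiset ℕ} (hs : ∀ m ∈ s, 0 < m)
    (hsum : (s.map Nat.totient).sum = 0) : s = 0 := by
  rcases Multiset.empty_or_exists_mem s with h0 | ⟨m, hm⟩
  · exact h0
  · exfalso
    have hle : Nat.totient m ≤ (s.map Nat.totient).sum :=
      Multiset.le_sum_of_mem (Multiset.mem_map_of_mem Nat.totient hm)
    have := Nat.totient_pos.mpr (hs m hm)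
    omega

/-- **Degree 57 reduces to degree 56**, conditional on [MRW08, Thm 1.1] ONLY (Smyth's hypothesis of
`Mahler.subLehmer_degree57_structure` removed; here DERIVED from `SmythFree.subLehmer_structure`: the
core has degree `56` and the cyclotomic cofactor `± x^a ∏ Φ_m` has degree `1`, i.e. is `± x`, `± Φ₁` or
`± Φ₂`). -/
theorem subLehmer_degree57_structure (h : SubLehmerDegreeBound) {P : ℤ[X]} (hdeg : P.natDegree = 57)
    (hP : SubLehmer P) :
    ∃ Q : ℤ[X], Q.natDegree = 56 ∧ SubLehmer Q ∧ (P = X * Q ∨ P = (X + 1) * Q ∨ P = (X - 1) * Q) := by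
  obtain ⟨u, a, s, Q, hu, hs, hPf, _, hQ, _, _, heven, hQ56, _, _, hdegs⟩ :=
    subLehmer_structure h hP (by omega)
  have hQd : Q.natDegree = 56 := by obtain ⟨k, hk⟩ := heven; omega
  have hcof : a + (s.map Nat.totient).sum = 1 := by omega
  -- the signed core `u · Q`
  have hCu : intMahlerMeasure (C u) = 1 := by
    rw [intMahlerMeasure_C]; rcases hu with rfl | rfl <;> simp
  have hQ'd : (C u * Q).natDegree = 56 := by
    rw [natDegree_C_mul (by rcases hu with rfl | rfl <;> norm_num), hQd]
  have hQ'sub : SubLehmer (C u * Q) := by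
    unfold SubLehmer at hQ ⊢
    rw [intMahlerMeasure_mul, hCu, one_mul]; exact hQ
  refine ⟨C u * Q, hQ'd, hQ'sub, ?_⟩
  rcases Nat.eq_zero_or_pos a with ha0 | hapos
  · -- `a = 0`: the cofactor is one cyclotomic polynomial `Φ_m` with `φ(m) = 1`, i.e. `m ∈ {1, 2}`
    subst ha0
    have hsum : (s.map Nat.totient).sum = 1 := by simpa using hcof
    obtain ⟨m, hm⟩ : ∃ m, m ∈ s := by
      rcases Multiset.empty_or_exists_mem s with h0 | hex
      · rw [h0] at hsum; simp at hsum
      · exact hex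
    obtain ⟨t, rfl⟩ := Multiset.exists_cons_of_mem hm
    rw [Multiset.map_cons, Multiset.sum_cons] at hsum
    have hφm : 0 < Nat.totient m := Nat.totient_pos.mpr (hs m hm)
    have ht0 : t = 0 :=
      eq_zero_of_totient_sum_eq_zero (fun x hx => hs x (Multiset.mem_cons_of_mem hx)) (by omega)
    subst ht0
    have hφ1 : Nat.totient m = 1 := by simpa using hsum
    rcases Nat.totient_eq_one_iff.mp hφ1 with rfl | rfl
    · right; right
      rw [hPf, Multiset.map_cons, Multiset.map_zero, Multiset.prod_cons, Multiset.prod_zero,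
        cyclotomic_one, pow_zero]; ring
    · right; left
      rw [hPf, Multiset.map_cons, Multiset.map_zero, Multiset.prod_cons, Multiset.prod_zero,
        cyclotomic_two, pow_zero]; ring
  · -- `a = 1`, `s = ∅`: the cofactor is `± x`
    have ha1 : a = 1 := by omega
    have hs0 : s = 0 := eq_zero_of_totient_sum_eq_zero hs (by omega)
    subst hs0; subst ha1
    left
    rw [hPf, Multiset.map_zero, Multiset.prod_zero, pow_one]; ring

end SmythFree

end Summit.Ventures.DiscreteObjects.Mahler
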